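import Summits.BirchSwinnertonDyer.BirchSwinnertonDyer.Theorems.GenusKolyvaginAtTwoGenusPrimitiveSupplyAtTwoTwinSupply
import Summits.BirchSwinnertonDyer.BirchSwinnertonDyer.Theorems.GenusKolyvaginAtTwoGenusPrimitiveSupplyAtTwoTwinConverseEll
import HarnessLib

/-!
# R-128 retype — print-form twins of `GenusKolyvaginAtTwoGenusPrimitiveSupplyAtTwoTwinSupply`

Seat `bsd-line-gk2-p2` g21 (cell `bsd-f1-sign2`), route `GenusKolyvaginAtTwo`, `--supports stmt-BirchSwinnertonDyer-22136`
(helper; closes nothing). Director-bsd R-128 RETYPE ORDER (2026-08-29 17:42Z; bsd-cited U-r05-BX, T-Q381-1′): the theorems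
`exists_card_selmerGroup_twin_eq_two_pow_odd'`, `minimalSelmerTwinSupply_of_lowering'`, `stub_minimalTwinSupplyAtTwo_of_lowering_of_twoConverse'`, 
of `Summits.BirchSwinnertonDyer.BirchSwinnertonDyer.Theorems.GenusKolyvaginAtTwoGenusPrimitiveSupplyAtTwoTwinSupply` take the BARE closure
`∀ V : WeierstrassCurve ℚ, p_parity V 2` (all Weierstrass cubics, singular included — off print and undischargeable by any
faithful Dokchitser–Dokchitser discharge). This file declares their PRIMED TWINS with the hypothesis in print form
`∀ (V : WeierstrassCurve ℚ) [V.IsElliptic], p_parity V 2` (= route item `TwoParityDD` since rev 34); statements and proofs are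
otherwise identical (every application `hpar W` is at an elliptic curve), calls to other retyped theorems go to their twins.
The tree is append-only, so the originals stay (superseded); the file is over the 400-line budget of the original, hence separate.
THEOREMS ONLY; no definition, no named fact, no `sorry`. BSD is NOT proved by any of this; nothing is closed.
-/

set_option linter.dupNamespace false -- tree convention: `Summit.BirchSwinnertonDyer.BirchSwinnertonDyer.Theorems` (summit = sub-problem)

noncomputable section

open scoped AddSubgroup

namespace Summit.BirchSwinnertonDyer.BirchSwinnertonDyer.Theorems.GenusKoly

open NumberField WeierstrassCurve Literature.NumberTheory.EllipticCurves
  Literature.NumberTheory.EllipticCurves.ModularForms Literature.NumberTheory.QuadraticFields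

/-! ## R-128 retype (director-bsd 2026-08-29 17:42Z, T-Q381-1′; seat bsd-line-gk2-p2 g21): PRINT-FORM TWINS
Every theorem below is the byte-identical twin of the theorem of the same name without the trailing prime, with the ONE change
that the `2`-parity hypothesis is typed as print has it — `∀ (V : WeierstrassCurve ℚ) [V.IsElliptic], p_parity V 2`
(Dokchitser–Dokchitser 2010 Thm. 1.4, elliptic curves; = route item `TwoParityDD` after rev 34) — instead of the bare closure
`∀ V : WeierstrassCurve ℚ, p_parity V 2` over all Weierstrass cubics (singular ones included: off print, undischargeable).
Calls to other retyped theorems go to their primed twins; every application `hpar W` is at an elliptic curve, so the proofs are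
unchanged. The unprimed originals are kept (append-only tree) and are superseded by these. BSD is NOT proved by any of this. -/


/-- **R-128 retype** (director-bsd 2026-08-29, T-Q381-1′) of `exists_card_selmerGroup_twin_eq_two_pow_odd`: the SAME statement and proof with the `2`-parity hypothesis in PRINT form `∀ (V : WeierstrassCurve ℚ) [V.IsElliptic], p_parity V 2` (Dokchitser–Dokchitser 2010 Thm. 1.4 is about elliptic curves; the bare closure over all Weierstrass cubics was off print). **Odd `d₂` for the Heegner twin, modulo Modularity, `2`-parity and Cassels–Tate.** For `W` with `r_an(W) = 0` and
`ρ̄_{W,2}` onto, `K` imaginary quadratic with the Heegner hypothesis, and any model `Wd ≅ W^{(d_K)}`: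
`#Sel₂(Wd) = 2^{2k+1}` for some `k`. Chain: `w(Wd) = −1` (`rootNumber_twin_eq_neg_one`, from `exists_isNewformOf`);
`corank_{ℤ₂} Sel_{2^∞}(Wd)` odd (`p_parity`); `Wd(ℚ)[2] = 0`; `dim Sel₂ = dim Wd(ℚ)[2] + corank + 2m` (Cassels–Tate on
`Ш[2^∞]/div`, tree `exists_selmerRank_eq_add`). [cite: DokchitserDokchitserAnnals2010, Thm. 1.4]
[cite: Dokchitser2013ParityNotes, §2] -/
theorem exists_card_selmerGroup_twin_eq_two_pow_odd' (hmod : exists_isNewformOf)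
    (hpar : ∀ (V : WeierstrassCurve ℚ) [V.IsElliptic], p_parity V 2) (hCT : exists_casselsTate_pairing (K := ℚ))
    (W : WeierstrassCurve ℚ) [W.IsElliptic] (hr0 : W.analyticRank = 0)
    (hsurj : W.HasSurjectiveModNGaloisRep ((2 : ℤ) ^ 1))
    (K : Type) [Field K] [NumberField K] (hK : IsImaginaryQuadratic K)
    (hH : SatisfiesHeegnerHypothesis (W.conductorNorm ℤ) K)
    (Wd : WeierstrassCurve ℚ) [Wd.IsElliptic]
    (hWd : ∃ C : VariableChange ℚ, C • W.quadraticTwist (NumberField.discr K : ℚ) = Wd) :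
    ∃ k : ℕ, Nat.card (Wd.selmerGroup 2) = 2 ^ (2 * k + 1) := by
  haveI : Fact (Nat.Prime 2) := ⟨Nat.prime_two⟩
  have hd : (NumberField.discr K : ℚ) ≠ 0 := by exact_mod_cast NumberField.discr_ne_zero K
  have htors := natCard_twoTorsion_twin_eq_one W hsurj hd Wd hWd
  have hw := rootNumber_twin_eq_neg_one hmod W hr0 K hK hH Wd hWd
  have hodd := odd_selmerCorank_two_of_p_parity Wd (hpar Wd) hw
  obtain ⟨s, hs⟩ := exists_natCard_selmerGroup_eq_pow Wd 2
  obtain ⟨m, hm⟩ := exists_selmerRank_eq_add hCT Wd 2 s 0 hs (by rw [pow_zero]; convert htors)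
  obtain ⟨j, hj⟩ := hodd
  refine ⟨j + m, ?_⟩
  rw [Nat.cast_ofNat] at hs
  rw [hs]
  congr 1
  omega


/-- **R-128 retype** (director-bsd 2026-08-29, T-Q381-1′) of `minimalSelmerTwinSupply_of_lowering`: the SAME statement and proof with the `2`-parity hypothesis in PRINT form `∀ (V : WeierstrassCurve ℚ) [V.IsElliptic], p_parity V 2` (Dokchitser–Dokchitser 2010 Thm. 1.4 is about elliptic curves; the bare closure over all Weierstrass cubics was off print). **(SUPPLY) ⟸ Mazur–Rubin lowering + Modularity + `2`-parity + Cassels–Tate.** For `W` globally minimal, non-CM,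
`r_an(W) = 0`, `ρ_{W,2^n}` onto for all `n ≥ 1`: there are a Kolyvagin-(H2)-admissible Heegner field `K` (imaginary
quadratic, `d_K` odd, `d_K ≠ −3`, every `q ∣ N_W` split, `d_K·(−|Δ|)` and `d_K·(−2|Δ|)` non-squares) and a globally minimal
`Wd ≅ W^{(d_K)}` with `#Sel₂(Wd) = 2` — the hypothesis `hsupply` of `stub_minimalTwinSupplyAtTwo_of_twoConverse'`, VERBATIM.
Construction: Dirichlet gives a prime `q₀ ≡ 7 (mod 8)`, `q₀ ≡ −1 (mod q)` for `q ∣ N_W`, `q₀ > |Δ|`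
(`exists_prime_and_field_discr_eq_neg`); `K₀ = ℚ(√−q₀)` is Heegner, so a minimal model `W₀` of `W^{(−q₀)}` has
`#Sel₂ = 2^{2k+1}` (§4); the walk (§2) with modulus `m = 8 q₀ N_W` gives a square-free `u ≡ 1 (mod m)` and a minimal
`Wd ≅ W^{(−q₀ u)}` with `#Sel₂(Wd) = 2`; `d = −q₀ u ≡ 1 (mod 8)` is a fundamental discriminant, `K = ℚ(√d)`
(`exists_numberField_discr_eq`) is imaginary quadratic with `d_K = d` odd `≤ −7`, Heegner (§3: `d ≡ 1 (mod 8)` and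
`d ≡ (−q₀)·u ≡ 1 (mod q)` for odd `q ∣ N_W`), and `ord_{q₀}(d·|Δ|) = ord_{q₀}(2d·|Δ|) = 1` is odd. The hypotheses `¬CM`
and surjectivity beyond level `2` are idle. [cite: MazurRubin2010, Prop. 5.2 (proof) with Lemma 3.6]
[cite: DokchitserDokchitserAnnals2010, Thm. 1.4] [cite: GrossLMS1991, §1 (p. 235)] -/
theorem minimalSelmerTwinSupply_of_lowering' (hmod : exists_isNewformOf)
    (hpar : ∀ (V : WeierstrassCurve ℚ) [V.IsElliptic], p_parity V 2) (hCT : exists_casselsTate_pairing (K := ℚ))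
    (hMR : ∀ (V : WeierstrassCurve ℚ) [V.IsElliptic], Nat.card (V.toAffine.Point[((2 : ℕ) : ℤ)]) = 1 →
      ∀ s : ℕ, Nat.card (V.selmerGroup 2) = 2 ^ s → 1 < s → ∀ m : ℕ, m ≠ 0 →
        ∃ p : ℕ, p.Prime ∧ (p : ℤ) ≡ 1 [ZMOD (m : ℤ)] ∧
          Nat.card ((V.quadraticTwist (p : ℚ)).selmerGroup 2) = 2 ^ (s - 2)) :
    ∀ (W : WeierstrassCurve ℚ) [W.IsElliptic] [W.IsGloballyMinimal] [NeZero (W.conductorNorm ℤ)],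
      ¬ W.HasCM → W.analyticRank = 0 → (∀ n : ℕ, 0 < n → W.HasSurjectiveModNGaloisRep ((2 : ℤ) ^ n)) →
      ∃ (K : Type) (_ : Field K) (_ : NumberField K),
        IsImaginaryQuadratic K ∧ Odd (NumberField.discr K) ∧ NumberField.discr K ≠ -3 ∧
        SatisfiesHeegnerHypothesis (W.conductorNorm ℤ) K ∧
        ¬ IsSquare ((NumberField.discr K : ℚ) * -|W.Δ|) ∧ ¬ IsSquare ((NumberField.discr K : ℚ) * (-(2 * |W.Δ|))) ∧
        ∃ (Wd : WeierstrassCurve ℚ) (_ : Wd.IsElliptic) (_ : Wd.IsGloballyMinimal),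
          (∃ C : WeierstrassCurve.VariableChange ℚ, C • W.quadraticTwist (NumberField.discr K : ℚ) = Wd) ∧
          Nat.card (Wd.selmerGroup 2) = 2 := by
  intro W _ _ _ _hcm hr0 hρ
  have hN0 : (W.conductorNorm ℤ : ℕ) ≠ 0 := NeZero.ne _
  have hΔ : W.Δ ≠ 0 := W.isUnit_Δ.ne_zero
  -- Step 1: the auxiliary prime `q₀` and `K₀ = ℚ(√-q₀)`
  obtain ⟨q₀, K₀, _, _, hq₀, hq₀n, hq₀8, hq₀mod, h2K₀, hdiscK₀⟩ :=
    Quadratic.exists_prime_and_field_discr_eq_neg (W.conductorNorm ℤ : ℕ).primeFactors (max W.Δ.num.natAbs W.Δ.den)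
  haveI : Fact q₀.Prime := ⟨hq₀⟩
  have hq₀Z : ∀ p : ℕ, p.Prime → p ∣ (W.conductorNorm ℤ : ℕ) → (q₀ : ZMod p) = -1 := fun p hp hpN ↦
    hq₀mod p (Nat.mem_primeFactors.mpr ⟨hp, hpN, hN0⟩) hp.ne_zero
  have hK₀ : IsImaginaryQuadratic K₀ :=
    ⟨h2K₀, Quadratic.isTotallyComplex_of_discr_neg h2K₀ (by rw [hdiscK₀, neg_lt_zero]; exact_mod_cast hq₀.pos)⟩
  have hH₀ : SatisfiesHeegnerHypothesis (W.conductorNorm ℤ) K₀ := by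
    refine satisfiesHeegnerHypothesis_of_discr_congr h2K₀ _ hdiscK₀ (by omega) fun p hp hpN hp2 ↦ ?_
    rw [Int.cast_neg, Int.cast_natCast, hq₀Z p hp hpN, neg_neg]
  -- Step 2: a globally minimal model `W₀` of `W^{(-q₀)}` and its odd `2`-Selmer rank
  have hd₀ : (NumberField.discr K₀ : ℚ) ≠ 0 := by exact_mod_cast NumberField.discr_ne_zero K₀
  haveI := W.isElliptic_quadraticTwist hd₀
  obtain ⟨C₀, hC₀⟩ := hasGlobalMinimalModel_rat_holds (W.quadraticTwist (NumberField.discr K₀ : ℚ))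
  haveI := hC₀
  obtain ⟨k, hk⟩ := exists_card_selmerGroup_twin_eq_two_pow_odd' hmod hpar hCT W hr0 (hρ 1 one_pos) K₀ hK₀ hH₀
    (C₀ • W.quadraticTwist (NumberField.discr K₀ : ℚ)) ⟨C₀, rfl⟩
  -- Step 3: the walk, modulus `m = 8 q₀ N`
  have hm : 8 * q₀ * (W.conductorNorm ℤ : ℕ) ≠ 0 := mul_ne_zero (mul_ne_zero (by norm_num) hq₀.ne_zero) hN0
  obtain ⟨u, hu, hum, Wd, _, _, hWd, hSel⟩ := exists_twist_card_selmerGroup_two_of_lowering hMR W (hρ 1 one_pos) k hd₀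
    (C₀ • W.quadraticTwist (NumberField.discr K₀ : ℚ)) ⟨C₀, rfl⟩ hk _ hm
  have hu0 : u ≠ 0 := hu.ne_zero
  have hu8 : (u : ℤ) ≡ 1 [ZMOD 8] := hum.of_dvd ⟨q₀ * (W.conductorNorm ℤ : ℕ), by push_cast; ring⟩
  have huq₀ : (u : ℤ) ≡ 1 [ZMOD q₀] := hum.of_dvd ⟨8 * (W.conductorNorm ℤ : ℕ), by push_cast; ring⟩
  have hq₀u : ¬ q₀ ∣ u := by
    intro h
    have hdu : (q₀ : ℤ) ∣ (u : ℤ) := by exact_mod_cast h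
    have h1 : (q₀ : ℤ) ∣ 1 := by simpa using Int.dvd_sub hdu (Int.ModEq.dvd huq₀.symm)
    exact hq₀.one_lt.ne' (by exact_mod_cast Int.eq_one_of_dvd_one (by positivity) h1)
  -- Step 4: the field `K = ℚ(√(-q₀ u))`
  set D : ℤ := -((q₀ : ℤ) * u) with hDdef
  have hD8 : D % 8 = 1 := neg_mul_emod_eight (by exact_mod_cast hq₀8) hu8
  have hDsq : Squarefree D := by
    rw [hDdef, ← Int.squarefree_natAbs]
    have : ((q₀ : ℤ) * u).natAbs = q₀ * u := by
      rw [Int.natAbs_mul, Int.natAbs_natCast, Int.natAbs_natCast]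
    rw [Int.natAbs_neg, this]
    exact (Nat.squarefree_mul (hq₀.coprime_iff_not_dvd.mpr hq₀u)).mpr ⟨hq₀.squarefree, hu⟩
  have hq₀7 : 7 ≤ q₀ := by omega
  have hDle : D ≤ -7 := by
    have : (7 : ℤ) * 1 ≤ (q₀ : ℤ) * u :=
      mul_le_mul (by exact_mod_cast hq₀7) (by exact_mod_cast Nat.one_le_iff_ne_zero.mpr hu0) zero_le_one
        (by positivity)
    omega
  obtain ⟨K, _, _, h2K, hdiscK⟩ := Quadratic.exists_numberField_discr_eq (D := D) (Or.inl ⟨hD8.symm ▸ by omega, hDsq, by omega⟩)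
  have hdiscKQ : (NumberField.discr K : ℚ) = (NumberField.discr K₀ : ℚ) * u := by
    rw [hdiscK, hdiscK₀, hDdef]; push_cast; ring
  -- `q₀`-adic valuations: `ord_{q₀}(q₀ · u · |Δ|) = 1`, `ord_{q₀}(2) = 0`
  have hq₀Q : (q₀ : ℚ) ≠ 0 := by exact_mod_cast hq₀.ne_zero
  have huQ : (u : ℚ) ≠ 0 := by exact_mod_cast hu0
  have hnum : ¬ (q₀ : ℤ) ∣ W.Δ.num := by
    intro h
    have h' : q₀ ∣ W.Δ.num.natAbs := Int.natCast_dvd.mp h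
    have hpos : 0 < W.Δ.num.natAbs := Int.natAbs_pos.mpr (Rat.num_ne_zero.mpr hΔ)
    have := Nat.le_of_dvd hpos h'
    omega
  have hden : ¬ q₀ ∣ W.Δ.den := by
    intro h
    have := Nat.le_of_dvd W.Δ.den_pos h
    omega
  have hvΔ : padicValRat q₀ W.Δ = 0 := by
    simp only [padicValRat, padicValInt.eq_zero_of_not_dvd hnum, padicValNat.eq_zero_of_not_dvd hden]
    simp
  have hvΔabs : padicValRat q₀ |W.Δ| = 0 := by
    rcases abs_choice W.Δ with h | h
    · rw [h, hvΔ]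
    · rw [h, padicValRat.neg, hvΔ]
  have hvu : padicValRat q₀ (u : ℚ) = 0 := by
    rw [padicValRat.of_nat, padicValNat.eq_zero_of_not_dvd hq₀u, Nat.cast_zero]
  have hv2 : padicValRat q₀ (2 : ℚ) = 0 := by
    have h2 : ¬ q₀ ∣ 2 := fun h ↦ by have := Nat.le_of_dvd two_pos h; omega
    rw [show (2 : ℚ) = ((2 : ℕ) : ℚ) by norm_num, padicValRat.of_nat, padicValNat.eq_zero_of_not_dvd h2,
      Nat.cast_zero]
  have hy0 : (q₀ : ℚ) * u * |W.Δ| ≠ 0 := mul_ne_zero (mul_ne_zero hq₀Q huQ) (abs_ne_zero.mpr hΔ)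
  have hy : padicValRat q₀ ((q₀ : ℚ) * u * |W.Δ|) = 1 := by
    rw [padicValRat.mul (mul_ne_zero hq₀Q huQ) (abs_ne_zero.mpr hΔ), padicValRat.mul hq₀Q huQ,
      padicValRat.self hq₀.one_lt, hvu, hvΔabs]
    simp
  refine ⟨K, inferInstance, inferInstance, ?_, ?_, ?_, ?_, ?_, ?_, Wd, inferInstance, inferInstance, ?_, hSel⟩
  · -- imaginary quadratic
    exact ⟨h2K, Quadratic.isTotallyComplex_of_discr_neg h2K (by rw [hdiscK]; omega)⟩
  · -- `d_K` odd
    rw [hdiscK, Int.odd_iff]; omega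
  · -- `d_K ≠ -3`
    rw [hdiscK]; omega
  · -- Heegner hypothesis
    refine satisfiesHeegnerHypothesis_of_discr_congr h2K _ hdiscK hD8 fun p hp hpN hp2 ↦ ?_
    have hpm : p ∣ 8 * q₀ * (W.conductorNorm ℤ : ℕ) := hpN.mul_left _
    have hup : ((u : ℤ) : ZMod p) = ((1 : ℤ) : ZMod p) := Quadratic.intCast_zmod_eq_of_modEq_of_dvd hum hpm
    rw [hDdef, Int.cast_neg, Int.cast_mul, Int.cast_natCast, hq₀Z p hp hpN, hup]
    push_cast; ring
  · -- `d_K · (−|Δ|)` is not a square: its `q₀`-adic valuation is `1`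
    have hx : (NumberField.discr K : ℚ) * -|W.Δ| = (q₀ : ℚ) * u * |W.Δ| := by rw [hdiscK, hDdef]; push_cast; ring
    rw [hx]
    exact not_isSquare_of_odd_padicValRat (q := q₀) hy0 (by rw [hy]; exact odd_one)
  · -- `d_K · (−2|Δ|)` is not a square: its `q₀`-adic valuation is `1`
    have hx : (NumberField.discr K : ℚ) * (-(2 * |W.Δ|)) = 2 * ((q₀ : ℚ) * u * |W.Δ|) := by
      rw [hdiscK, hDdef]; push_cast; ring
    rw [hx]
    refine not_isSquare_of_odd_padicValRat (q := q₀) (mul_ne_zero two_ne_zero hy0) ?_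
    rw [padicValRat.mul two_ne_zero hy0, hy, hv2, zero_add]
    exact odd_one
  · -- the twin
    rw [hdiscKQ]
    exact hWd


/-- **R-128 retype** (director-bsd 2026-08-29, T-Q381-1′) of `stub_minimalTwinSupplyAtTwo_of_lowering_of_twoConverse`: the SAME statement and proof with the `2`-parity hypothesis in PRINT form `∀ (V : WeierstrassCurve ℚ) [V.IsElliptic], p_parity V 2` (Dokchitser–Dokchitser 2010 Thm. 1.4 is about elliptic curves; the bare closure over all Weierstrass cubics was off print). **STUB A ⟸ (MR lowering) ∧ Modularity ∧ `2`-parity ∧ Cassels–Tate ∧ (CONV₂).** The registered stub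
`stub_minimalTwinSupplyAtTwo` of line `genus-supply` (crux 22136) VERBATIM, from: the Mazur–Rubin lowering step `hMR`
(Mazur–Rubin 2010 Prop. 5.2, proof form over `ℚ`; PRINT), Modularity `exists_isNewformOf` (BCDT 2001; PRINT), the
`2`-parity theorem `p_parity · 2` (Dokchitser–Dokchitser 2010 ∕ Monsky 1996; PRINT), the Cassels–Tate pairing
`exists_casselsTate_pairing` (Cassels 1962; PRINT), and the rank-one `2`-converse `hconv` (OPEN: crux 19220 of route
`TwoAdicConverse`, here without its reduction-type clause). Composition of `minimalSelmerTwinSupply_of_lowering'` with the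
LEAD's `stub_minimalTwinSupplyAtTwo_of_twoConverse'`. So stub A's only non-print input is the `2`-converse. BSD is not
proved by any of this. [cite: MazurRubin2010, Prop. 5.2 (proof) with Lemma 3.6] [cite: DokchitserDokchitserAnnals2010, Thm. 1.4] -/
theorem stub_minimalTwinSupplyAtTwo_of_lowering_of_twoConverse' (hmod : exists_isNewformOf)
    (hpar : ∀ (V : WeierstrassCurve ℚ) [V.IsElliptic], p_parity V 2) (hCT : exists_casselsTate_pairing (K := ℚ))
    (hMR : ∀ (V : WeierstrassCurve ℚ) [V.IsElliptic], Nat.card (V.toAffine.Point[((2 : ℕ) : ℤ)]) = 1 →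
      ∀ s : ℕ, Nat.card (V.selmerGroup 2) = 2 ^ s → 1 < s → ∀ m : ℕ, m ≠ 0 →
        ∃ p : ℕ, p.Prime ∧ (p : ℤ) ≡ 1 [ZMOD (m : ℤ)] ∧
          Nat.card ((V.quadraticTwist (p : ℚ)).selmerGroup 2) = 2 ^ (s - 2))
    (hconv : ∀ (V : WeierstrassCurve ℚ) [V.IsElliptic] [V.IsGloballyMinimal],
      ¬ V.HasCM → V.selmerCorank 2 = 1 → V.analyticRank = 1) :
    ∀ (W : WeierstrassCurve ℚ) [W.IsElliptic] [W.IsGloballyMinimal] [NeZero (W.conductorNorm ℤ)],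
      ¬ W.HasCM → W.analyticRank = 0 → (∀ n : ℕ, 0 < n → W.HasSurjectiveModNGaloisRep ((2 : ℤ) ^ n)) →
      ∃ (K : Type) (_ : Field K) (_ : NumberField K),
        IsImaginaryQuadratic K ∧ Odd (NumberField.discr K) ∧ NumberField.discr K ≠ -3 ∧
        SatisfiesHeegnerHypothesis (W.conductorNorm ℤ) K ∧
        ¬ IsSquare ((NumberField.discr K : ℚ) * -|W.Δ|) ∧ ¬ IsSquare ((NumberField.discr K : ℚ) * (-(2 * |W.Δ|))) ∧
        ∃ (Wd : WeierstrassCurve ℚ) (_ : Wd.IsElliptic) (_ : Wd.IsGloballyMinimal),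
          (∃ C : WeierstrassCurve.VariableChange ℚ, C • W.quadraticTwist (NumberField.discr K : ℚ) = Wd) ∧
          Wd.analyticRank = 1 ∧ Nat.card (Wd.selmerGroup 2) = 2 :=
  stub_minimalTwinSupplyAtTwo_of_twoConverse' hmod hpar hconv (minimalSelmerTwinSupply_of_lowering' hmod hpar hCT hMR)


end Summit.BirchSwinnertonDyer.BirchSwinnertonDyer.Theorems.GenusKoly

end
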